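import Literature.NumberTheory.LFunctions.BCHCrossTermStationaryPhase
import Literature.Analysis.Fourier.FresnelConstantValue
import HarnessLib

/-!
# The cross term of the BCH mean square: reduction of the stationary-phase main sum

Topic `Literature/NumberTheory/LFunctions`. Everything in this file is PROVED (no named facts; the
only definition is the transparent `BCH.crossNuSet`, the finite set of `ν` switched on for a given
`(h, k, μ)`).

`BCH.norm_crossTerm_sub_mainSum_le` (file `BCHCrossTermStationaryPhase.lean`) leaves the main sum
`e^{-iπ/4} Σ_{h,k ≤ N} a_h ā_k (hk)^{-1/2} Σ_{μ,ν ≤ X} (μν)^{-1/2} crossMain(T,T',h,k,μ,ν)`,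
`crossMain = [max(T,θ) ≤ c ≤ T'] 𝔣 e^{-ic} c^{1/2}`, `c = 2πμνh/k`, `θ = 2π max(μ², ν²)`.
Here it is reduced to exponential sums (Titchmarsh §9.22 / Levinson 1974 §5):

* `BCH.crossAct_le_crossFreq_iff` — the activation condition `θ ≤ c` is `μk ≤ νh ∧ νk ≤ μh`;
* `BCH.weight_mul_sqrt_crossFreq` — `(hk)^{-1/2}(μν)^{-1/2} c^{1/2} = (2π)^{1/2}/k`;
* `BCH.phase_weight_crossMain_eq` — with `e^{-iπ/4}𝔣 = (2π)^{1/2}`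
  (`Literature.Analysis.Fourier.cexp_neg_mul_fresnelC`):
  `e^{-iπ/4}(hk)^{-1/2}(μν)^{-1/2} crossMain = [T ≤ c ≤ T', μk ≤ νh, νk ≤ μh] (2π/k) e^{-ic}`;
* `BCH.mainSum_eq` — **the main sum is** `Σ_{h,k} a_h ā_k (2π/k) Σ_{μ ≤ X} Σ_{ν ∈ crossNuSet} e^{-ic}`;
* `BCH.crossNuSet_ordConnected`, `BCH.crossNuSet_eq_Icc` — for fixed `(h,k,μ)` the switched-on `ν`
  form an interval of integers (so the `ν`-sum is a geometric sum in `e(−νμh/k)`).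

## References

* [Titchmarsh1986] E. C. Titchmarsh, *The Theory of the Riemann Zeta-Function*, 2nd ed. (1986), §9.22
  (the sum `2π Σ e^{-2πi mn h/k}` after Lemma 9.23).
* [Levinson1974] N. Levinson, Adv. Math. 13 (1974), §5.
-/

noncomputable section

open Finset Real Complex
open scoped ComplexConjugate

namespace Literature.NumberTheory.LFunctions.BCH

/-! ### The activation condition -/

/-- `θ ≤ c ⟺ μk ≤ νh ∧ νk ≤ μh` (`2πμ² ≤ 2πμνh/k ⟺ μk ≤ νh`). [folklore] -/
theorem crossAct_le_crossFreq_iff {h k μ ν : ℕ} (hk : 0 < k) (hμ : 0 < μ) (hν : 0 < ν) :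
    crossAct μ ν ≤ crossFreq h k μ ν ↔ μ * k ≤ ν * h ∧ ν * k ≤ μ * h := by
  have hkR : (0 : ℝ) < k := by exact_mod_cast hk
  have hμR : (0 : ℝ) < μ := by exact_mod_cast hμ
  have hνR : (0 : ℝ) < ν := by exact_mod_cast hν
  have hπ := Real.pi_pos
  rw [crossAct_def, crossFreq_def, max_le_iff]
  have e1 : 2 * π * (μ : ℝ) ^ 2 ≤ 2 * π * μ * ν * h / k ↔ μ * k ≤ ν * h := by
    rw [le_div_iff₀ hkR]
    constructor
    · intro H
      have : (2 * π * μ) * ((μ : ℝ) * k) ≤ (2 * π * μ) * ((ν : ℝ) * h) := by nlinarith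
      have := le_of_mul_le_mul_left this (by positivity)
      exact_mod_cast this
    · intro H
      have H' : (μ : ℝ) * k ≤ ν * h := by exact_mod_cast H
      nlinarith [mul_le_mul_of_nonneg_left H' (by positivity : (0:ℝ) ≤ 2 * π * μ)]
  have e2 : 2 * π * (ν : ℝ) ^ 2 ≤ 2 * π * μ * ν * h / k ↔ ν * k ≤ μ * h := by
    rw [le_div_iff₀ hkR]
    constructor
    · intro H
      have : (2 * π * ν) * ((ν : ℝ) * k) ≤ (2 * π * ν) * ((μ : ℝ) * h) := by nlinarith
      have := le_of_mul_le_mul_left this (by positivity)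
      exact_mod_cast this
    · intro H
      have H' : (ν : ℝ) * k ≤ μ * h := by exact_mod_cast H
      nlinarith [mul_le_mul_of_nonneg_left H' (by positivity : (0:ℝ) ≤ 2 * π * ν)]
  rw [e1, e2]

/-! ### The weight of a stationary quadruple -/

/-- `(hk)^{-1/2}(μν)^{-1/2} c^{1/2} = (2π)^{1/2}/k` (`c = 2πμνh/k`). [cite: Titchmarsh1986, §9.22] -/
theorem weight_mul_sqrt_crossFreq {h k μ ν : ℕ} (hh : 0 < h) (hk : 0 < k) (hμ : 0 < μ) (hν : 0 < ν) :
    ((h : ℝ) * k) ^ (-(1 / 2 : ℝ)) * ((μ : ℝ) * ν) ^ (-(1 / 2 : ℝ)) * Real.sqrt (crossFreq h k μ ν) =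
      Real.sqrt (2 * π) / k := by
  have hhR : (0 : ℝ) < h := by exact_mod_cast hh
  have hkR : (0 : ℝ) < k := by exact_mod_cast hk
  have hμR : (0 : ℝ) < μ := by exact_mod_cast hμ
  have hνR : (0 : ℝ) < ν := by exact_mod_cast hν
  have hsh : Real.sqrt h ≠ 0 := (Real.sqrt_pos.2 hhR).ne'
  have hsk : Real.sqrt k ≠ 0 := (Real.sqrt_pos.2 hkR).ne'
  have hsμ : Real.sqrt μ ≠ 0 := (Real.sqrt_pos.2 hμR).ne'
  have hsν : Real.sqrt ν ≠ 0 := (Real.sqrt_pos.2 hνR).ne'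
  have e1 : ((h : ℝ) * k) ^ (-(1 / 2 : ℝ)) = 1 / (Real.sqrt h * Real.sqrt k) := by
    rw [Real.rpow_neg (by positivity), ← Real.sqrt_eq_rpow, Real.sqrt_mul hhR.le, one_div]
  have e2 : ((μ : ℝ) * ν) ^ (-(1 / 2 : ℝ)) = 1 / (Real.sqrt μ * Real.sqrt ν) := by
    rw [Real.rpow_neg (by positivity), ← Real.sqrt_eq_rpow, Real.sqrt_mul hμR.le, one_div]
  have e3 : Real.sqrt (crossFreq h k μ ν) =
      Real.sqrt (2 * π) * Real.sqrt μ * Real.sqrt ν * Real.sqrt h / Real.sqrt k := by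
    rw [crossFreq_def, Real.sqrt_div' _ hkR.le, Real.sqrt_mul (by positivity),
      Real.sqrt_mul (by positivity), Real.sqrt_mul (by positivity)]
  rw [e1, e2, e3]
  conv_rhs => rw [show (k : ℝ) = Real.sqrt k * Real.sqrt k from (Real.mul_self_sqrt hkR.le).symm]
  field_simp

/-! ### The stationary quadruple, simplified -/

/-- **`e^{-iπ/4}(hk)^{-1/2}(μν)^{-1/2} crossMain = [T ≤ c ≤ T', μk ≤ νh, νk ≤ μh] (2π/k) e^{-ic}`.**
[cite: Titchmarsh1986, §9.22] -/
theorem phase_weight_crossMain_eq (T T' : ℝ) {h k μ ν : ℕ} (hh : 0 < h) (hk : 0 < k)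
    (hμ : 0 < μ) (hν : 0 < ν) :
    cexp (-(I * (π / 4 : ℝ))) * ((((h : ℝ) * k) ^ (-(1 / 2 : ℝ)) : ℝ) : ℂ) *
        (((((μ : ℝ) * ν) ^ (-(1 / 2 : ℝ)) : ℝ) : ℂ) * crossMain T T' h k μ ν) =
      if T ≤ crossFreq h k μ ν ∧ crossFreq h k μ ν ≤ T' ∧ μ * k ≤ ν * h ∧ ν * k ≤ μ * h then
        (((2 * π / k : ℝ)) : ℂ) * cexp (-I * crossFreq h k μ ν) else 0 := by
  rw [crossMain_def]
  have hiff : (max T (crossAct μ ν) ≤ crossFreq h k μ ν ∧ crossFreq h k μ ν ≤ T') ↔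
      (T ≤ crossFreq h k μ ν ∧ crossFreq h k μ ν ≤ T' ∧ μ * k ≤ ν * h ∧ ν * k ≤ μ * h) := by
    rw [max_le_iff, crossAct_le_crossFreq_iff hk hμ hν]
    tauto
  by_cases hc : T ≤ crossFreq h k μ ν ∧ crossFreq h k μ ν ≤ T' ∧ μ * k ≤ ν * h ∧ ν * k ≤ μ * h
  · rw [if_pos hc, if_pos (hiff.2 hc)]
    have hw := weight_mul_sqrt_crossFreq hh hk hμ hν
    have hF := Literature.Analysis.Fourier.cexp_neg_mul_fresnelC
    -- rearrange: (e^{-iπ/4} 𝔣) · ((hk)^{-1/2}(μν)^{-1/2}√c) · e^{-ic}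
    have e : cexp (-(I * (π / 4 : ℝ))) * ((((h : ℝ) * k) ^ (-(1 / 2 : ℝ)) : ℝ) : ℂ) *
        (((((μ : ℝ) * ν) ^ (-(1 / 2 : ℝ)) : ℝ) : ℂ) *
          (Literature.Analysis.Fourier.fresnelC * cexp (-I * crossFreq h k μ ν) *
            (Real.sqrt (crossFreq h k μ ν) : ℂ))) =
        (cexp (-(π / 4 : ℝ) * I) * Literature.Analysis.Fourier.fresnelC) *
          ((((h : ℝ) * k) ^ (-(1 / 2 : ℝ)) * ((μ : ℝ) * ν) ^ (-(1 / 2 : ℝ)) *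
            Real.sqrt (crossFreq h k μ ν) : ℝ) : ℂ) * cexp (-I * crossFreq h k μ ν) := by
      rw [show -(I * ((π / 4 : ℝ) : ℂ)) = -((π / 4 : ℝ) : ℂ) * I by ring]
      push_cast
      ring
    rw [e, hF, hw]
    push_cast
    have hkC : (k : ℂ) ≠ 0 := by exact_mod_cast hk.ne'
    have hs : ((Real.sqrt (2 * π) : ℝ) : ℂ) * (Real.sqrt (2 * π) : ℂ) = ((2 * π : ℝ) : ℂ) := by
      rw [← Complex.ofReal_mul, Real.mul_self_sqrt (by positivity)]
    push_cast at hs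
    field_simp
    rw [← hs]
    ring
  · rw [if_neg hc, if_neg (fun h' => hc (hiff.1 h')), mul_zero, mul_zero]

/-! ### The switched-on `ν` of a triple `(h,k,μ)` -/

/-- The set of `ν ≤ X` switched on for `(h,k,μ)` on `[T, T']`:
`{ν ∈ [1, X] : T ≤ 2πμνh/k ≤ T', μk ≤ νh, νk ≤ μh}`. [folklore] -/
def crossNuSet (T T' : ℝ) (X h k μ : ℕ) : Finset ℕ :=
  (Finset.Icc 1 X).filter fun ν =>
    T ≤ crossFreq h k μ ν ∧ crossFreq h k μ ν ≤ T' ∧ μ * k ≤ ν * h ∧ ν * k ≤ μ * h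

/-- Unfolding `crossNuSet`. [folklore] -/
theorem mem_crossNuSet {T T' : ℝ} {X h k μ ν : ℕ} :
    ν ∈ crossNuSet T T' X h k μ ↔ ν ∈ Finset.Icc 1 X ∧
      (T ≤ crossFreq h k μ ν ∧ crossFreq h k μ ν ≤ T' ∧ μ * k ≤ ν * h ∧ ν * k ≤ μ * h) := by
  rw [crossNuSet, Finset.mem_filter]

/-- `crossNuSet ⊆ [1, X]`. [folklore] -/
theorem crossNuSet_subset (T T' : ℝ) (X h k μ : ℕ) : crossNuSet T T' X h k μ ⊆ Finset.Icc 1 X :=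
  Finset.filter_subset _ _

/-- The `(μ,ν)`-sum of one pair `(h,k)`:
`e^{-iπ/4}(hk)^{-1/2} Σ_{μ,ν ≤ X}(μν)^{-1/2} crossMain = (2π/k) Σ_{μ ≤ X} Σ_{ν ∈ crossNuSet} e^{-ic}`.
[cite: Titchmarsh1986, §9.22] -/
theorem pairMainSum_eq (T T' : ℝ) (X : ℕ) {h k : ℕ} (hh : 0 < h) (hk : 0 < k) :
    cexp (-(I * (π / 4 : ℝ))) * ((((h : ℝ) * k) ^ (-(1 / 2 : ℝ)) : ℝ) : ℂ) *
        ∑ μ ∈ Finset.Icc 1 X, ∑ ν ∈ Finset.Icc 1 X,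
          ((((μ : ℝ) * ν) ^ (-(1 / 2 : ℝ)) : ℝ) : ℂ) * crossMain T T' h k μ ν =
      (((2 * π / k : ℝ)) : ℂ) *
        ∑ μ ∈ Finset.Icc 1 X, ∑ ν ∈ crossNuSet T T' X h k μ, cexp (-I * crossFreq h k μ ν) := by
  rw [Finset.mul_sum, Finset.mul_sum]
  refine Finset.sum_congr rfl fun μ hμ => ?_
  have hμ0 : 0 < μ := (Finset.mem_Icc.1 hμ).1
  simp only [crossNuSet, Finset.sum_filter, Finset.mul_sum]
  refine Finset.sum_congr rfl fun ν hν => ?_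
  have hν0 : 0 < ν := (Finset.mem_Icc.1 hν).1
  rw [phase_weight_crossMain_eq T T' hh hk hμ0 hν0]
  split_ifs <;> simp

/-- **The main sum of the cross term as a double exponential sum.** For any `T, T'`, `X`:
`e^{-iπ/4} Σ_{h,k ≤ N} a_h ā_k (hk)^{-1/2} Σ_{μ,ν ≤ X} (μν)^{-1/2} crossMain`
`  = Σ_{h,k ≤ N} a_h ā_k (2π/k) Σ_{μ ≤ X} Σ_{ν ∈ crossNuSet} e^{-ic}`. [cite: Titchmarsh1986, §9.22] -/
theorem mainSum_eq (a : ℕ → ℂ) (N X : ℕ) (T T' : ℝ) :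
    cexp (-(I * (π / 4 : ℝ))) * ∑ h ∈ Finset.Icc 1 N, ∑ k ∈ Finset.Icc 1 N,
        a h * conj (a k) * ((((h : ℝ) * k) ^ (-(1 / 2 : ℝ)) : ℝ) : ℂ) *
          ∑ μ ∈ Finset.Icc 1 X, ∑ ν ∈ Finset.Icc 1 X,
            ((((μ : ℝ) * ν) ^ (-(1 / 2 : ℝ)) : ℝ) : ℂ) * crossMain T T' h k μ ν =
      ∑ h ∈ Finset.Icc 1 N, ∑ k ∈ Finset.Icc 1 N,
        a h * conj (a k) * (((2 * π / k : ℝ)) : ℂ) *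
          ∑ μ ∈ Finset.Icc 1 X, ∑ ν ∈ crossNuSet T T' X h k μ, cexp (-I * crossFreq h k μ ν) := by
  rw [Finset.mul_sum]
  refine Finset.sum_congr rfl fun h hh => ?_
  rw [Finset.mul_sum]
  refine Finset.sum_congr rfl fun k hk => ?_
  have hh0 : 0 < h := (Finset.mem_Icc.1 hh).1
  have hk0 : 0 < k := (Finset.mem_Icc.1 hk).1
  have key := pairMainSum_eq T T' X hh0 hk0
  calc cexp (-(I * (π / 4 : ℝ))) * (a h * conj (a k) * ((((h : ℝ) * k) ^ (-(1 / 2 : ℝ)) : ℝ) : ℂ) *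
        ∑ μ ∈ Finset.Icc 1 X, ∑ ν ∈ Finset.Icc 1 X,
          ((((μ : ℝ) * ν) ^ (-(1 / 2 : ℝ)) : ℝ) : ℂ) * crossMain T T' h k μ ν)
      = a h * conj (a k) * (cexp (-(I * (π / 4 : ℝ))) * ((((h : ℝ) * k) ^ (-(1 / 2 : ℝ)) : ℝ) : ℂ) *
        ∑ μ ∈ Finset.Icc 1 X, ∑ ν ∈ Finset.Icc 1 X,
          ((((μ : ℝ) * ν) ^ (-(1 / 2 : ℝ)) : ℝ) : ℂ) * crossMain T T' h k μ ν) := by ring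
    _ = _ := by rw [key]; ring

/-! ### The switched-on `ν` form an interval -/

/-- `crossNuSet` is order-connected: if `ν₁ ≤ ν ≤ ν₂` with `ν₁, ν₂` switched on, so is `ν`
(each defining condition is monotone in `ν`). [folklore] -/
theorem crossNuSet_ordConnected {T T' : ℝ} {X h k μ ν₁ ν ν₂ : ℕ}
    (h₁ : ν₁ ∈ crossNuSet T T' X h k μ) (h₂ : ν₂ ∈ crossNuSet T T' X h k μ)
    (hle₁ : ν₁ ≤ ν) (hle₂ : ν ≤ ν₂) : ν ∈ crossNuSet T T' X h k μ := by
  rw [mem_crossNuSet] at h₁ h₂ ⊢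
  obtain ⟨hI₁, hT₁, -, hμ₁, -⟩ := h₁
  obtain ⟨hI₂, -, hT₂, -, hν₂⟩ := h₂
  have hmono : ∀ {x y : ℕ}, x ≤ y → crossFreq h k μ x ≤ crossFreq h k μ y := by
    intro x y hxy
    rw [crossFreq_def, crossFreq_def]
    have : (x : ℝ) ≤ y := by exact_mod_cast hxy
    have hk0 : (0 : ℝ) ≤ k := Nat.cast_nonneg k
    apply div_le_div_of_nonneg_right _ hk0
    have hh0 : (0 : ℝ) ≤ h := Nat.cast_nonneg h
    exact mul_le_mul_of_nonneg_right (mul_le_mul_of_nonneg_left this (by positivity)) hh0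
  refine ⟨?_, hT₁.trans (hmono hle₁), (hmono hle₂).trans hT₂, hμ₁.trans (Nat.mul_le_mul_right h hle₁),
    (Nat.mul_le_mul_right k hle₂).trans hν₂⟩
  rw [Finset.mem_Icc] at hI₁ hI₂ ⊢
  exact ⟨hI₁.1.trans hle₁, hle₂.trans hI₂.2⟩

/-- **The switched-on `ν` form an integer interval**: if `crossNuSet` is nonempty it equals
`[min, max]`. [folklore] -/
theorem crossNuSet_eq_Icc {T T' : ℝ} {X h k μ : ℕ} (hne : (crossNuSet T T' X h k μ).Nonempty) :
    crossNuSet T T' X h k μ =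
      Finset.Icc ((crossNuSet T T' X h k μ).min' hne) ((crossNuSet T T' X h k μ).max' hne) := by
  ext ν
  constructor
  · intro hν
    exact Finset.mem_Icc.2 ⟨Finset.min'_le _ _ hν, Finset.le_max' _ _ hν⟩
  · intro hν
    rw [Finset.mem_Icc] at hν
    exact crossNuSet_ordConnected (Finset.min'_mem _ hne) (Finset.max'_mem _ hne) hν.1 hν.2

/-- Consequently the switched-on `ν` are `Ioc a b` for some `a < b` — or the set is empty. [folklore] -/
theorem crossNuSet_eq_Ioc (T T' : ℝ) (X h k μ : ℕ) :
    ∃ a b : ℕ, b ≤ X ∧ crossNuSet T T' X h k μ = Finset.Ioc a b := by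
  rcases (crossNuSet T T' X h k μ).eq_empty_or_nonempty with he | hne
  · exact ⟨0, 0, Nat.zero_le X, by rw [he]; simp⟩
  · refine ⟨(crossNuSet T T' X h k μ).min' hne - 1, (crossNuSet T T' X h k μ).max' hne, ?_, ?_⟩
    · have := crossNuSet_subset T T' X h k μ (Finset.max'_mem _ hne)
      exact (Finset.mem_Icc.1 this).2
    · have h1 : 1 ≤ (crossNuSet T T' X h k μ).min' hne := by
        have := crossNuSet_subset T T' X h k μ (Finset.min'_mem _ hne)
        exact (Finset.mem_Icc.1 this).1
      ext ν
      rw [Finset.mem_Ioc]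
      constructor
      · intro hν
        have hmin := Finset.min'_le _ _ hν
        have hmax := Finset.le_max' _ _ hν
        omega
      · intro hν
        exact crossNuSet_ordConnected (Finset.min'_mem _ hne) (Finset.max'_mem _ hne) (by omega) hν.2

end Literature.NumberTheory.LFunctions.BCH
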